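import Literature.Analysis.FluidPDE.LinearizedOseenLayers
import Mathlib.Topology.Algebra.InfiniteSum.Real
import HarnessLib

/-!
# The linearised Oseen problem with a lacunary singular coefficient: resummation of the dyadic
  layers and the solution from time zero (Coiculescu–Palasek, Props. 4.2–4.3, linear part, in
  forcing form)

Analysis/FluidPDE support file (definitions `layerBoundExt`, `partialSol`, `linSol`,
`linSolConst`; everything else proved), continuing `LinearizedOseenLayers.lean`, for the
perturbation theorem of M. P. Coiculescu, S. Palasek, *Non-uniqueness of smooth solutions of the
Navier–Stokes equations from critical data*, Invent. Math. 244 (2025) = arXiv:2503.14699,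
Props. 4.2–4.3 (hypothesis `hB` of
`Literature.Barriers.NavierStokesRegularity.CriticalDataSmoothNonuniqueness_of_principalParts_of_perturbationThreshold`).

The partial sums `W_n = Σ_{j≤n} w_j` of the layer solutions solve, by FINITE linearity, the
window problem with the cumulative free term `Φ_{s_{n+1}}` (`partialSol_eq`); the layer bounds
`‖w_j‖ ≤ R_j` (Prop. 4.2 per layer) resum over the dyadic layers
(`Literature.Analysis.ODE.tsum_dyadic_rpow_le`) into `Σ_j R_j(t) ≤ C_L N t^{α-1/2}` once the power
loss `Λη ≤ α/2` (Prop. 4.3: "`∫₀ᵗ (t')^{-1+α-ε} dt' ≲ t^{α-ε}`", `ε < α`), so `W_n → W` pointwise with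
`‖W(t)‖ ≤ C_L N t^{α-1/2}`; and the equation passes to the limit by dominated convergence in the
slots of the bilinear term under the singular envelopes `V ≤ K₀τ^{-1/2}`, `C_L N τ^{α-1/2}`
(`tendsto_oseenDuhamel_of_dominated`). Main statement: `linSol_spec` — the solution `W` of
`W = Φ₀ - B₀(v, W) - B₀(W, v)` on `(0, T]` from the forcing pairs, jointly measurable, vanishing off
`(0, T]`, with `‖W(t)(x)‖ ≤ C_L N t^{α-1/2}`.

## References

* M. P. Coiculescu, S. Palasek, Invent. Math. 244 (2025) = arXiv:2503.14699: Props. 4.2–4.3 and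
  their proofs, App. B Prop. B.1. [`CoiculescuPalasek2025`]
-/

noncomputable section

open MeasureTheory Set Function Filter
open _root_.Topology
open scoped ENNReal

namespace Literature.Analysis.FluidPDE

open Literature.Analysis.ODE

variable {E : Type*} [NormedAddCommGroup E] [InnerProductSpace ℝ E] [FiniteDimensional ℝ E]
  [MeasurableSpace E] [BorelSpace E]
variable {ι : Type*} [Fintype ι]

/-! ### Definitions -/

variable (E) in
/-- The layer bound extended by zero below the layer's window: `R̃_n(t) = 𝟙_{s_{n+1} < t} R_n(t)`.
[folklore] -/
def layerBoundExt (T α N K₀ C η : ℝ) (n : ℕ) (t : ℝ) : ℝ :=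
  if dyadicTime T (n + 1) < t then layerBound E T α N K₀ C η n t else 0

/-- **The partial sums** `W_n = Σ_{j ≤ n} w_j` of the layer solutions. [cite: CoiculescuPalasek2025, proof of Prop. 4.3] -/
def partialSol (T : ℝ) (v : ℝ → E → E) (a b : ι → ℝ → E → E) (n : ℕ) (t : ℝ) (x : E) : E :=
  ∑ j ∈ Finset.range (n + 1), layerSol T v a b j t x

/-- **The solution from time zero** `W = lim_n W_n = Σ_j w_j`. [cite: CoiculescuPalasek2025, proof of Prop. 4.3] -/
def linSol (T : ℝ) (v : ℝ → E → E) (a b : ι → ℝ → E → E) (t : ℝ) (x : E) : E :=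
  limUnder atTop fun n => partialSol T v a b n t x

variable (E) in
/-- **The constant of the linear estimate** `C_L = C_* / (1 - 2^{-α/2})`. [cite: CoiculescuPalasek2025, Props. 4.2–4.3] -/
def linSolConst (α K₀ C : ℝ) : ℝ := layerConst E K₀ C / (1 - (2 : ℝ) ^ (-(α / 2)))

/-- `1 - 2^{-α/2} > 0` for `α > 0`. [folklore] -/
theorem one_sub_two_rpow_neg_pos {α : ℝ} (hα : 0 < α) : 0 < 1 - (2 : ℝ) ^ (-(α / 2)) := by
  have : (2 : ℝ) ^ (-(α / 2)) < 1 := Real.rpow_lt_one_of_one_lt_of_neg (by norm_num) (by linarith)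
  linarith

/-- `C_L > 0` for `α > 0`. [folklore] -/
theorem linSolConst_pos {α : ℝ} (hα : 0 < α) (K₀ C : ℝ) : 0 < linSolConst E α K₀ C :=
  div_pos (layerConst_pos K₀ C) (one_sub_two_rpow_neg_pos hα)

/-! ### The layer bounds resummed -/

section Bounds

variable {T α N K₀ C η : ℝ} {a b : ι → ℝ → E → E} {A B : ι → ℝ → ℝ} {v : ℝ → E → E} {V : ℝ → ℝ}

/-- `‖w_n(t)(x)‖ ≤ R̃_n(t)` everywhere. [cite: CoiculescuPalasek2025, Prop. 4.2] -/
theorem norm_layerSol_le_ext (hF : ForcingPairs T α N a b A B) (hv : LacunaryCoeff T K₀ C η v V)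
    (n : ℕ) (t : ℝ) (x : E) : ‖layerSol T v a b n t x‖ ≤ layerBoundExt E T α N K₀ C η n t := by
  unfold layerBoundExt
  split_ifs with h
  · by_cases ht : t ≤ T
    · exact norm_layerSol_le hF hv n ⟨h, ht⟩ x
    · rw [layerSol_of_not_mem hF hv n (fun hm => ht hm.2) x, norm_zero]
      exact layerBound_nonneg hF.T_pos hF.N_nonneg n ((dyadicTime_pos hF.T_pos _).le.trans h.le)
  · rw [layerSol_of_not_mem hF hv n (fun hm => h hm.1) x, norm_zero]

/-- `R̃_n(t) ≥ 0`. [folklore] -/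
theorem layerBoundExt_nonneg (hF : ForcingPairs T α N a b A B) (n : ℕ) (t : ℝ) :
    0 ≤ layerBoundExt E T α N K₀ C η n t := by
  unfold layerBoundExt
  split_ifs with h
  · exact layerBound_nonneg hF.T_pos hF.N_nonneg n ((dyadicTime_pos hF.T_pos _).le.trans h.le)
  · exact le_rfl

/-- The extended layer bound in dyadic form: for `t > 0`,
`R̃_n(t) ≤ C_* N t^{Λη - 1/2} · 𝟙_{(T/2)2^{-n} < t} ((T/2)2^{-n})^{α - Λη}`. [folklore] -/
theorem layerBoundExt_le_dyadic (hF : ForcingPairs T α N a b A B) (K₀ C η : ℝ)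
    (n : ℕ) {t : ℝ} (ht : 0 < t) :
    layerBoundExt E T α N K₀ C η n t ≤
      layerConst E K₀ C * N * t ^ (gronwallRate E K₀ C * η - 1 / 2) *
        (if T / 2 * (2 : ℝ)⁻¹ ^ n < t then (T / 2 * (2 : ℝ)⁻¹ ^ n) ^ (α - gronwallRate E K₀ C * η)
          else 0) := by
  have hs : 0 < dyadicTime T (n + 1) := dyadicTime_pos hF.T_pos _
  set ε := gronwallRate E K₀ C * η with hε
  rw [← dyadicTime_succ_eq]
  unfold layerBoundExt
  split_ifs with h
  · unfold layerBound
    rw [← hε]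
    have e1 : (t / dyadicTime T (n + 1)) ^ ε = t ^ ε * dyadicTime T (n + 1) ^ (-ε) := by
      rw [Real.div_rpow ht.le hs.le, Real.rpow_neg hs.le, div_eq_mul_inv]
    have e2 : dyadicTime T (n + 1) ^ α * dyadicTime T (n + 1) ^ (-ε) =
        dyadicTime T (n + 1) ^ (α - ε) := by
      rw [← Real.rpow_add hs]; ring_nf
    have e3 : t ^ ε * t ^ (-(1 / 2 : ℝ)) = t ^ (ε - 1 / 2) := by
      rw [← Real.rpow_add ht]; ring_nf
    calc layerConst E K₀ C * N * dyadicTime T (n + 1) ^ α * (t / dyadicTime T (n + 1)) ^ ε *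
          t ^ (-(1 / 2 : ℝ))
        = layerConst E K₀ C * N * (t ^ ε * t ^ (-(1 / 2 : ℝ))) *
            (dyadicTime T (n + 1) ^ α * dyadicTime T (n + 1) ^ (-ε)) := by rw [e1]; ring
      _ = layerConst E K₀ C * N * t ^ (ε - 1 / 2) * dyadicTime T (n + 1) ^ (α - ε) := by
          rw [e2, e3]
      _ ≤ _ := le_rfl
  · rw [mul_zero]

/-- **Resummation of the layer bounds**: for `t ∈ (0, T]` and `Λη ≤ α/2`, the series `Σ_n R̃_n(t)` is
summable with sum `≤ C_L N t^{α-1/2}` (`Literature.Analysis.ODE.tsum_dyadic_rpow_le` with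
`β = α - Λη ≥ α/2`). [cite: CoiculescuPalasek2025, proof of Prop. 4.3] -/
theorem summable_layerBoundExt (hF : ForcingPairs T α N a b A B) (hv : LacunaryCoeff T K₀ C η v V)
    (hε : gronwallRate E K₀ C * η ≤ α / 2) {t : ℝ} (ht : 0 < t) :
    Summable (fun n => layerBoundExt E T α N K₀ C η n t) ∧
      ∑' n, layerBoundExt E T α N K₀ C η n t ≤ linSolConst E α K₀ C * N * t ^ (α - 1 / 2) := by
  set ε := gronwallRate E K₀ C * η with hεdef
  set β := α - ε with hβ
  have hε0 : 0 ≤ ε := mul_nonneg (gronwallRate_nonneg hv.K₀_nonneg hv.C_nonneg) hv.η_nonneg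
  have hβ0 : 0 < β := by rw [hβ]; linarith [hF.α_pos]
  have hT2 : 0 < T / 2 := by linarith [hF.T_pos]
  have hC := (layerConst_pos (E := E) K₀ C).le
  obtain ⟨hsum, htsum⟩ := tsum_dyadic_rpow_le hβ0 hT2 ht
  set K : ℝ := layerConst E K₀ C * N * t ^ (ε - 1 / 2) with hK
  have hK0 : 0 ≤ K := by
    have := hF.N_nonneg; have := (Real.rpow_pos_of_pos ht (ε - 1 / 2)).le; positivity
  have hle : ∀ n, layerBoundExt E T α N K₀ C η n t ≤
      K * (if T / 2 * (2 : ℝ)⁻¹ ^ n < t then (T / 2 * (2 : ℝ)⁻¹ ^ n) ^ β else 0) := fun n =>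
    layerBoundExt_le_dyadic hF K₀ C η n ht
  have hsum' : Summable fun n => K * (if T / 2 * (2 : ℝ)⁻¹ ^ n < t then (T / 2 * (2 : ℝ)⁻¹ ^ n) ^ β
      else 0) := hsum.mul_left K
  have hS : Summable fun n => layerBoundExt E T α N K₀ C η n t :=
    Summable.of_nonneg_of_le (fun n => layerBoundExt_nonneg hF n t) hle hsum'
  refine ⟨hS, ?_⟩
  calc ∑' n, layerBoundExt E T α N K₀ C η n t
      ≤ ∑' n, K * (if T / 2 * (2 : ℝ)⁻¹ ^ n < t then (T / 2 * (2 : ℝ)⁻¹ ^ n) ^ β else 0) :=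
        hS.tsum_le_tsum hle hsum'
    _ = K * ∑' n, (if T / 2 * (2 : ℝ)⁻¹ ^ n < t then (T / 2 * (2 : ℝ)⁻¹ ^ n) ^ β else 0) :=
        tsum_mul_left
    _ ≤ K * (t ^ β / (1 - (2 : ℝ) ^ (-β))) := mul_le_mul_of_nonneg_left htsum hK0
    _ ≤ K * (t ^ β / (1 - (2 : ℝ) ^ (-(α / 2)))) := by
        refine mul_le_mul_of_nonneg_left ?_ hK0
        have h1 : 0 < 1 - (2 : ℝ) ^ (-(α / 2)) := one_sub_two_rpow_neg_pos hF.α_pos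
        refine div_le_div_of_nonneg_left (Real.rpow_nonneg ht.le _) h1 ?_
        have : (2 : ℝ) ^ (-β) ≤ (2 : ℝ) ^ (-(α / 2)) :=
          Real.rpow_le_rpow_of_exponent_le (by norm_num) (by linarith)
        linarith
    _ = linSolConst E α K₀ C * N * t ^ (α - 1 / 2) := by
        have e : t ^ (ε - 1 / 2) * t ^ β = t ^ (α - 1 / 2) := by
          rw [← Real.rpow_add ht]; rw [hβ]; ring_nf
        rw [← e, hK, linSolConst]
        ring

/-- Finite sums of the layer bounds are at most `C_L N t^{α-1/2}`. [cite: CoiculescuPalasek2025, proof of Prop. 4.3] -/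
theorem sum_layerBoundExt_le (hF : ForcingPairs T α N a b A B) (hv : LacunaryCoeff T K₀ C η v V)
    (hε : gronwallRate E K₀ C * η ≤ α / 2) {t : ℝ} (ht : 0 < t) (n : ℕ) :
    ∑ j ∈ Finset.range n, layerBoundExt E T α N K₀ C η j t ≤ linSolConst E α K₀ C * N * t ^ (α - 1 / 2) :=
  ((summable_layerBoundExt hF hv hε ht).1.sum_le_tsum _ (fun j _ => layerBoundExt_nonneg hF j t)).trans
    (summable_layerBoundExt hF hv hε ht).2

end Bounds

/-! ### The partial sums -/

section Partial

variable {T α N K₀ C η : ℝ} {a b : ι → ℝ → E → E} {A B : ι → ℝ → ℝ} {v : ℝ → E → E} {V : ℝ → ℝ}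

/-- `W_{n+1} = W_n + w_{n+1}`. [folklore] -/
theorem partialSol_succ (T : ℝ) (v : ℝ → E → E) (a b : ι → ℝ → E → E) (n : ℕ) :
    partialSol T v a b (n + 1) = partialSol T v a b n + layerSol T v a b (n + 1) := by
  funext t x
  simp only [partialSol, Pi.add_apply, Finset.sum_range_succ _ (n + 1)]

/-- `W_0 = w_0`. [folklore] -/
theorem partialSol_zero (T : ℝ) (v : ℝ → E → E) (a b : ι → ℝ → E → E) :
    partialSol T v a b 0 = layerSol T v a b 0 := by
  funext t x
  simp [partialSol]

/-- Joint measurability of the partial sums. [folklore] -/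
theorem measurable_uncurry_partialSol (hF : ForcingPairs T α N a b A B)
    (hv : LacunaryCoeff T K₀ C η v V) (n : ℕ) : Measurable (uncurry (partialSol T v a b n)) := by
  induction n with
  | zero => rw [partialSol_zero]; exact measurable_uncurry_layerSol hF hv 0
  | succ n ih =>
    rw [partialSol_succ]
    exact ih.add (measurable_uncurry_layerSol hF hv (n + 1))

/-- Bound of the partial sums by the finite sums of layer bounds. [folklore] -/
theorem norm_partialSol_le_sum (hF : ForcingPairs T α N a b A B) (hv : LacunaryCoeff T K₀ C η v V)
    (n : ℕ) (t : ℝ) (x : E) :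
    ‖partialSol T v a b n t x‖ ≤ ∑ j ∈ Finset.range (n + 1), layerBoundExt E T α N K₀ C η j t :=
  (norm_sum_le _ _).trans (Finset.sum_le_sum fun j _ => norm_layerSol_le_ext hF hv j t x)

/-- **Bound of the partial sums**: `‖W_n(t)(x)‖ ≤ C_L N t^{α-1/2}` for `t > 0`. [cite: CoiculescuPalasek2025, proof of Prop. 4.3] -/
theorem norm_partialSol_le (hF : ForcingPairs T α N a b A B) (hv : LacunaryCoeff T K₀ C η v V)
    (hε : gronwallRate E K₀ C * η ≤ α / 2) (n : ℕ) {t : ℝ} (ht : 0 < t) (x : E) :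
    ‖partialSol T v a b n t x‖ ≤ linSolConst E α K₀ C * N * t ^ (α - 1 / 2) :=
  (norm_partialSol_le_sum hF hv n t x).trans (sum_layerBoundExt_le hF hv hε ht (n + 1))

/-- The partial sums vanish off `(0, T]`. [folklore] -/
theorem partialSol_of_not_mem (hF : ForcingPairs T α N a b A B) (hv : LacunaryCoeff T K₀ C η v V)
    (n : ℕ) {t : ℝ} (ht : t ∉ Ioc 0 T) (x : E) : partialSol T v a b n t x = 0 := by
  unfold partialSol
  refine Finset.sum_eq_zero fun j _ => layerSol_of_not_mem hF hv j (fun h => ht ?_) x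
  exact ⟨(dyadicTime_pos hF.T_pos _).trans h.1, h.2⟩

/-- The partial sum `W_n` vanishes below `s_{n+1}`. [folklore] -/
theorem partialSol_of_le (hF : ForcingPairs T α N a b A B) (hv : LacunaryCoeff T K₀ C η v V)
    (n : ℕ) {t : ℝ} (ht : t ≤ dyadicTime T (n + 1)) (x : E) : partialSol T v a b n t x = 0 := by
  unfold partialSol
  refine Finset.sum_eq_zero fun j hj => layerSol_of_not_mem hF hv j (fun h => ?_) x
  have hjn : j + 1 ≤ n + 1 := by simpa using Finset.mem_range.1 hj
  have hmono : dyadicTime T (n + 1) ≤ dyadicTime T (j + 1) := by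
    unfold dyadicTime
    exact mul_le_mul_of_nonneg_left (pow_le_pow_of_le_one (by norm_num) (by norm_num) hjn)
      hF.T_pos.le
  exact absurd (h.1.trans_le (ht.trans hmono)) (lt_irrefl _)

/-- Distance between consecutive partial sums. [folklore] -/
theorem dist_partialSol_succ_le (hF : ForcingPairs T α N a b A B) (hv : LacunaryCoeff T K₀ C η v V)
    (n : ℕ) (t : ℝ) (x : E) :
    dist (partialSol T v a b n t x) (partialSol T v a b (n + 1) t x) ≤
      layerBoundExt E T α N K₀ C η (n + 1) t := by
  rw [partialSol_succ, Pi.add_apply, Pi.add_apply, dist_eq_norm, sub_add_cancel_left, norm_neg]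
  exact norm_layerSol_le_ext hF hv (n + 1) t x

end Partial

/-! ### The limit -/

section Limit

variable {T α N K₀ C η : ℝ} {a b : ι → ℝ → E → E} {A B : ι → ℝ → ℝ} {v : ℝ → E → E} {V : ℝ → ℝ}

/-- **Pointwise convergence of the partial sums** to `linSol` (for `t > 0` the layer bounds are
summable; for `t ≤ 0` everything vanishes). [cite: CoiculescuPalasek2025, proof of Prop. 4.3] -/
theorem tendsto_partialSol (hF : ForcingPairs T α N a b A B) (hv : LacunaryCoeff T K₀ C η v V)
    (hε : gronwallRate E K₀ C * η ≤ α / 2) (t : ℝ) (x : E) :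
    Tendsto (fun n => partialSol T v a b n t x) atTop (𝓝 (linSol T v a b t x)) := by
  haveI : CompleteSpace E := FiniteDimensional.complete ℝ E
  rcases le_or_gt t 0 with ht | ht
  · have h0 : (fun n => partialSol T v a b n t x) = fun _ => 0 :=
      funext fun n => partialSol_of_not_mem hF hv n (fun h => absurd h.1 (not_lt.2 ht)) x
    have hlim : linSol T v a b t x = 0 := by
      unfold linSol
      rw [h0]
      exact tendsto_nhds_unique (tendsto_nhds_limUnder ⟨0, tendsto_const_nhds⟩) tendsto_const_nhds
    rw [hlim, h0]
    exact tendsto_const_nhds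
  · have hc : CauchySeq fun n => partialSol T v a b n t x :=
      cauchySeq_of_dist_le_of_summable _ (dist_partialSol_succ_le hF hv · t x)
        ((summable_nat_add_iff 1).2 (summable_layerBoundExt hF hv hε ht).1)
    exact hc.tendsto_limUnder

/-- **The solution is jointly measurable.** [folklore] -/
theorem measurable_uncurry_linSol (hF : ForcingPairs T α N a b A B) (hv : LacunaryCoeff T K₀ C η v V)
    (hε : gronwallRate E K₀ C * η ≤ α / 2) : Measurable (uncurry (linSol T v a b)) := by
  refine measurable_of_tendsto_metrizable (f := fun n => uncurry (partialSol T v a b n))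
    (measurable_uncurry_partialSol hF hv) ?_
  rw [tendsto_pi_nhds]
  exact fun q => tendsto_partialSol hF hv hε q.1 q.2

/-- The solution vanishes off `(0, T]`. [folklore] -/
theorem linSol_of_not_mem (hF : ForcingPairs T α N a b A B) (hv : LacunaryCoeff T K₀ C η v V)
    (hε : gronwallRate E K₀ C * η ≤ α / 2) {t : ℝ} (ht : t ∉ Ioc 0 T) (x : E) :
    linSol T v a b t x = 0 := by
  have h := tendsto_partialSol hF hv hε t x
  rw [show (fun n => partialSol T v a b n t x) = fun _ => 0 from
    funext fun n => partialSol_of_not_mem hF hv n ht x] at h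
  exact tendsto_nhds_unique h tendsto_const_nhds

/-- **The linear estimate (Props. 4.2–4.3 of Coiculescu–Palasek, linear part, forcing form)**:
`‖W(t)(x)‖ ≤ C_L N t^{α-1/2}` for `t > 0`. [cite: CoiculescuPalasek2025, Props. 4.2–4.3] -/
theorem norm_linSol_le (hF : ForcingPairs T α N a b A B) (hv : LacunaryCoeff T K₀ C η v V)
    (hε : gronwallRate E K₀ C * η ≤ α / 2) {t : ℝ} (ht : 0 < t) (x : E) :
    ‖linSol T v a b t x‖ ≤ linSolConst E α K₀ C * N * t ^ (α - 1 / 2) :=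
  le_of_tendsto ((tendsto_partialSol hF hv hε t x).norm)
    (Eventually.of_forall fun n => norm_partialSol_le hF hv hε n ht x)

end Limit

/-! ### The equations -/

section Equation

variable {T α N K₀ C η : ℝ} {a b : ι → ℝ → E → E} {A B : ι → ℝ → ℝ} {v : ℝ → E → E} {V : ℝ → ℝ}

/-- The slice operator vanishes when one field vanishes identically at that time. [folklore] -/
theorem oseenSlice_eq_zero_of_right {σ : ℝ} {f g : E → E} (hg : ∀ y, g y = 0) (x : E) :
    oseenSlice σ f g x = 0 := by
  have : g = 0 := funext hg
  rw [this, oseenSlice_zero_right]; rfl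

/-- The slice operator vanishes when one field vanishes identically at that time. [folklore] -/
theorem oseenSlice_eq_zero_of_left {σ : ℝ} {f g : E → E} (hf : ∀ y, f y = 0) (x : E) :
    oseenSlice σ f g x = 0 := by
  have : f = 0 := funext hf
  rw [this, oseenSlice_zero_left]; rfl

omit [InnerProductSpace ℝ E] [FiniteDimensional ℝ E] [BorelSpace E] in
/-- **Envelope integrability against the singular coefficient for fields vanishing near zero**: if
`‖w τ y‖ ≤ M` everywhere and `w τ = 0` for `τ ≤ σ` with `σ > 0`, then with
`M_w(τ) = 𝟙_{σ<τ} M` the envelope `(t-τ)^{-1/2} V(τ) M_w(τ)` is integrable on `(0, t)`, `t ≤ T`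
(`V ≤ K₀ σ^{-1/2}` beyond `σ`). [folklore] -/
theorem integrableOn_coeff_envelope_of_vanishing (hv : LacunaryCoeff T K₀ C η v V) {σ t M : ℝ}
    (hσ : 0 < σ) (ht : t ≤ T) (hM : 0 ≤ M) :
    IntegrableOn (fun τ => (t - τ) ^ (-(1 / 2 : ℝ)) * (V τ * (if σ < τ then M else 0))) (Ioo 0 t) ∧
    IntegrableOn (fun τ => (t - τ) ^ (-(1 / 2 : ℝ)) * ((if σ < τ then M else 0) * V τ)) (Ioo 0 t) := by
  have hsub : Ioo 0 t ⊆ Ioc 0 T := fun τ hτ => ⟨hτ.1, hτ.2.le.trans ht⟩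
  have hmeas : AEStronglyMeasurable (fun τ => V τ * (if σ < τ then M else 0))
      (volume.restrict (Ioo 0 t)) := by
    refine ((hv.cont.mono hsub).aestronglyMeasurable measurableSet_Ioo).mul ?_
    have : (fun τ : ℝ => if σ < τ then M else 0) = (Ioi σ).indicator fun _ => M := by
      funext τ; simp only [indicator, mem_Ioi]
    rw [this]
    exact (aestronglyMeasurable_const.indicator measurableSet_Ioi).restrict
  have hbd : ∀ τ ∈ Ioo 0 t, |V τ * (if σ < τ then M else 0)| ≤ K₀ * (Real.sqrt σ)⁻¹ * M := by
    intro τ hτ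
    have hK := hv.K₀_nonneg
    split_ifs with h
    · have hτ' := hsub hτ
      have hVle : V τ ≤ K₀ * (Real.sqrt σ)⁻¹ := by
        have hk := hv.kato τ hτ'
        have hsτ : 0 < Real.sqrt τ := Real.sqrt_pos.2 hτ.1
        have hsσ : 0 < Real.sqrt σ := Real.sqrt_pos.2 hσ
        have h1 : V τ ≤ K₀ * (Real.sqrt τ)⁻¹ := by
          rw [← div_eq_mul_inv, le_div_iff₀ hsτ, mul_comm]; exact hk
        refine h1.trans (mul_le_mul_of_nonneg_left ?_ hK)
        exact inv_anti₀ hsσ (Real.sqrt_le_sqrt h.le)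
      rw [abs_of_nonneg (mul_nonneg (hv.nonneg τ hτ') hM)]
      exact mul_le_mul_of_nonneg_right hVle hM
    · rw [mul_zero, abs_zero]; positivity
  have h1 := integrableOn_abelKernel_mul hmeas hbd
  refine ⟨h1, h1.congr (Eventually.of_forall fun τ => ?_)⟩
  simp only [mul_comm (V τ)]

/-- **The layer equation from time zero.** For `t ∈ (0, T]`:
`w_n(t)(x) = Ψ_n(t)(x) - B₀(v, w_n)(t)(x) - B₀(w_n, v)(t)(x)` (from `layerSol_eq`: on the window the
coefficient agrees with `v` and the integrands vanish below `s_{n+1}`; below the window every term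
vanishes). [cite: CoiculescuPalasek2025, App. B, Prop. B.1] -/
theorem layerSol_eq_zero_from (hF : ForcingPairs T α N a b A B) (hv : LacunaryCoeff T K₀ C η v V)
    (n : ℕ) {t : ℝ} (ht : t ∈ Ioc 0 T) (x : E) :
    layerSol T v a b n t x = layerFree T a b n t x -
      oseenDuhamel 1 0 v (layerSol T v a b n) t x - oseenDuhamel 1 0 (layerSol T v a b n) v t x := by
  set s := dyadicTime T (n + 1) with hsdef
  set w := layerSol T v a b n with hwdef
  have hs : 0 < s := dyadicTime_pos hF.T_pos _
  have hw0 : ∀ τ, τ ≤ s → ∀ y, w τ y = 0 := fun τ hτ y =>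
    layerSol_of_not_mem hF hv n (fun h => absurd h.1 (not_lt.2 hτ)) y
  obtain ⟨Mw, hMw⟩ := exists_norm_layerSol_le hF hv n
  have hMw0 : 0 ≤ Mw := (norm_nonneg _).trans (hMw 0 0)
  -- the `B₀` terms only see `(s, t)`, where the layer coefficient is `v`
  have hD1 : oseenDuhamel 1 0 v w t x = oseenDuhamel 1 s (layerCoeff T v n) w t x := by
    rcases le_or_gt t s with hts | hts
    · rw [oseenDuhamel_of_le _ _ hts x, oseenDuhamel_one_eq_setIntegral_oseenSlice]
      refine setIntegral_eq_zero_of_forall_eq_zero fun τ hτ => ?_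
      exact oseenSlice_eq_zero_of_right (hw0 τ (hτ.2.le.trans hts)) x
    · -- split `(0,t)` at `s`: the part below `s` vanishes, the part above has coefficient `v`
      have henv := (integrableOn_coeff_envelope_of_vanishing hv hs ht.2 hMw0).1
      have hint : IntegrableOn (fun τ => oseenSlice (t - τ) (v τ) (w τ) x) (Ioo 0 t) := by
        refine integrableOn_oseenSlice_of_envelope hv.meas (measurable_uncurry_layerSol hF hv n)
          (fun τ hτ y => hv.bound τ ⟨hτ.1, hτ.2.le.trans ht.2⟩ y) (fun τ hτ y => ?_) henv x
        split_ifs with h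
        · exact hMw τ y
        · rw [show layerSol T v a b n τ y = 0 from hw0 τ (not_lt.1 h) y, norm_zero]
      have hdiff := oseenDuhamel_sub_oseenDuhamel_eq_setIntegral hs.le hint
      have hzero : ∫ τ in Ioo 0 t ∩ Iic s, oseenSlice (t - τ) (v τ) (w τ) x = 0 :=
        setIntegral_eq_zero_of_forall_eq_zero fun τ hτ => oseenSlice_eq_zero_of_right (hw0 τ hτ.2) x
      rw [hzero, sub_eq_zero] at hdiff
      rw [hdiff, oseenDuhamel_one_eq_setIntegral_oseenSlice, oseenDuhamel_one_eq_setIntegral_oseenSlice]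
      refine setIntegral_congr_fun measurableSet_Ioo fun τ hτ => ?_
      rw [layerCoeff, show windowTrunc (dyadicTime T (n + 1)) T v τ = v τ from
        funext fun y => windowTrunc_of_mem ⟨hτ.1, hτ.2.le.trans ht.2⟩ y]
  have hD2 : oseenDuhamel 1 0 w v t x = oseenDuhamel 1 s w (layerCoeff T v n) t x := by
    rcases le_or_gt t s with hts | hts
    · rw [oseenDuhamel_of_le _ _ hts x, oseenDuhamel_one_eq_setIntegral_oseenSlice]
      refine setIntegral_eq_zero_of_forall_eq_zero fun τ hτ => ?_
      exact oseenSlice_eq_zero_of_left (hw0 τ (hτ.2.le.trans hts)) x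
    · have henv := (integrableOn_coeff_envelope_of_vanishing hv hs ht.2 hMw0).2
      have hint : IntegrableOn (fun τ => oseenSlice (t - τ) (w τ) (v τ) x) (Ioo 0 t) := by
        refine integrableOn_oseenSlice_of_envelope (measurable_uncurry_layerSol hF hv n) hv.meas
          (fun τ hτ y => ?_) (fun τ hτ y => hv.bound τ ⟨hτ.1, hτ.2.le.trans ht.2⟩ y) henv x
        split_ifs with h
        · exact hMw τ y
        · rw [show layerSol T v a b n τ y = 0 from hw0 τ (not_lt.1 h) y, norm_zero]
      have hdiff := oseenDuhamel_sub_oseenDuhamel_eq_setIntegral hs.le hint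
      have hzero : ∫ τ in Ioo 0 t ∩ Iic s, oseenSlice (t - τ) (w τ) (v τ) x = 0 :=
        setIntegral_eq_zero_of_forall_eq_zero fun τ hτ => oseenSlice_eq_zero_of_left (hw0 τ hτ.2) x
      rw [hzero, sub_eq_zero] at hdiff
      rw [hdiff, oseenDuhamel_one_eq_setIntegral_oseenSlice, oseenDuhamel_one_eq_setIntegral_oseenSlice]
      refine setIntegral_congr_fun measurableSet_Ioo fun τ hτ => ?_
      rw [layerCoeff, show windowTrunc (dyadicTime T (n + 1)) T v τ = v τ from
        funext fun y => windowTrunc_of_mem ⟨hτ.1, hτ.2.le.trans ht.2⟩ y]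
  rcases le_or_gt t s with hts | hts
  · -- below the window everything vanishes
    have h1 : w t x = 0 := hw0 t hts x
    have h2 : layerFree T a b n t x = 0 := layerFree_of_not_mem n (fun h => absurd h.1 (not_lt.2 hts)) x
    have h3 : oseenDuhamel 1 0 v w t x = 0 := by rw [hD1, oseenDuhamel_of_le _ _ hts x]
    have h4 : oseenDuhamel 1 0 w v t x = 0 := by rw [hD2, oseenDuhamel_of_le _ _ hts x]
    rw [h1, h2, h3, h4]; simp
  · have h : w t x = layerFree T a b n t x -
        (oseenDuhamel 1 s (layerCoeff T v n) w t x + oseenDuhamel 1 s w (layerCoeff T v n) t x) :=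
      layerSol_eq hF hv n ⟨hts, ht.2⟩ x
    rw [hD1, hD2, h]
    abel

/-- Envelope of the partial sum `W_n` near zero: it vanishes below `s_{n+1}` and is bounded by the
sum of the global bounds of its layers. [folklore] -/
theorem exists_envelope_partialSol (hF : ForcingPairs T α N a b A B) (hv : LacunaryCoeff T K₀ C η v V)
    (n : ℕ) : ∃ M : ℝ, 0 ≤ M ∧ (∀ τ y, ‖partialSol T v a b n τ y‖ ≤ M) ∧
      ∀ τ y, ‖partialSol T v a b n τ y‖ ≤ if dyadicTime T (n + 1) < τ then M else 0 := by
  have hglob : ∃ M : ℝ, 0 ≤ M ∧ ∀ τ y, ‖partialSol T v a b n τ y‖ ≤ M := by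
    induction n with
    | zero =>
      obtain ⟨M, hM⟩ := exists_norm_layerSol_le hF hv 0
      exact ⟨M, (norm_nonneg _).trans (hM 0 0), fun τ y => by rw [partialSol_zero]; exact hM τ y⟩
    | succ n ih =>
      obtain ⟨M, hM0, hM⟩ := ih
      obtain ⟨M', hM'⟩ := exists_norm_layerSol_le hF hv (n + 1)
      refine ⟨M + M', add_nonneg hM0 ((norm_nonneg _).trans (hM' 0 0)), fun τ y => ?_⟩
      rw [partialSol_succ, Pi.add_apply, Pi.add_apply]
      exact (norm_add_le _ _).trans (add_le_add (hM τ y) (hM' τ y))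
  obtain ⟨M, hM0, hM⟩ := hglob
  refine ⟨M, hM0, hM, fun τ y => ?_⟩
  split_ifs with h
  · exact hM τ y
  · rw [partialSol_of_le hF hv n (not_lt.1 h) y, norm_zero]

/-- **The cumulative equation of the partial sums from time zero.** For `t ∈ (0, T]`:
`W_n(t)(x) = Σ_{j≤n} Ψ_j(t)(x) - B₀(v, W_n)(t)(x) - B₀(W_n, v)(t)(x)` (finite additivity of the
bilinear term under the envelopes). [cite: CoiculescuPalasek2025, proof of Prop. 4.3] -/
theorem partialSol_eq (hF : ForcingPairs T α N a b A B) (hv : LacunaryCoeff T K₀ C η v V) (n : ℕ)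
    {t : ℝ} (ht : t ∈ Ioc 0 T) (x : E) :
    partialSol T v a b n t x = (∑ j ∈ Finset.range (n + 1), layerFree T a b j t x) -
      oseenDuhamel 1 0 v (partialSol T v a b n) t x - oseenDuhamel 1 0 (partialSol T v a b n) v t x := by
  induction n with
  | zero =>
    rw [partialSol_zero, Finset.sum_range_one]
    exact layerSol_eq_zero_from hF hv 0 ht x
  | succ n ih =>
    have hs : 0 < dyadicTime T (n + 2) := dyadicTime_pos hF.T_pos _
    have hvb : ∀ τ ∈ Ioo 0 t, ∀ y, ‖v τ y‖ ≤ V τ := fun τ hτ y => hv.bound τ ⟨hτ.1, hτ.2.le.trans ht.2⟩ y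
    -- envelopes of `W_n` and `w_{n+1}`, both vanishing below `s_{n+2}`
    obtain ⟨M₁, hM₁0, -, hM₁⟩ := exists_envelope_partialSol hF hv n
    obtain ⟨M₂', hM₂'⟩ := exists_norm_layerSol_le hF hv (n + 1)
    have hM₂0 : 0 ≤ M₂' := (norm_nonneg _).trans (hM₂' 0 0)
    have hM₂ : ∀ τ y, ‖layerSol T v a b (n + 1) τ y‖ ≤ if dyadicTime T (n + 2) < τ then M₂' else 0 := by
      intro τ y
      split_ifs with h
      · exact hM₂' τ y
      · rw [layerSol_of_not_mem hF hv (n + 1) (fun hm => h hm.1) y, norm_zero]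
    have hM₁' : ∀ τ y, ‖partialSol T v a b n τ y‖ ≤ if dyadicTime T (n + 2) < τ then M₁ else 0 := by
      intro τ y
      refine (hM₁ τ y).trans ?_
      have hmono : dyadicTime T (n + 2) ≤ dyadicTime T (n + 1) :=
        (dyadicTime_succ_lt hF.T_pos (n + 1)).le
      split_ifs with h1 h2 h2
      · exact le_rfl
      · exact absurd (hmono.trans_lt h1) h2
      · exact hM₁0
      · exact le_rfl
    have henv₁ := integrableOn_coeff_envelope_of_vanishing hv hs ht.2 hM₁0 (t := t)
    have henv₂ := integrableOn_coeff_envelope_of_vanishing hv hs ht.2 hM₂0 (t := t)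
    have hmP := measurable_uncurry_partialSol hF hv n
    have hmw := measurable_uncurry_layerSol hF hv (n + 1)
    rw [partialSol_succ, Finset.sum_range_succ, Pi.add_apply, Pi.add_apply,
      oseenDuhamel_add_right_of_envelope hv.meas hmP hmw hvb (fun τ _ y => hM₁' τ y)
        (fun τ _ y => hM₂ τ y) henv₁.1 henv₂.1 x,
      oseenDuhamel_add_left_of_envelope hmP hmw hv.meas (fun τ _ y => hM₁' τ y)
        (fun τ _ y => hM₂ τ y) hvb henv₁.2 henv₂.2 x,
      ih, layerSol_eq_zero_from hF hv (n + 1) ht x]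
    abel

/-- **Telescoping of the layer free terms**: `Σ_{j≤n} Ψ_j(t) = Φ_{s_{n+1}}(t)` for `t ∈ (0, T]`.
[folklore] -/
theorem sum_layerFree_eq (hF : ForcingPairs T α N a b A B) (n : ℕ) {t : ℝ} (ht : t ∈ Ioc 0 T) (x : E) :
    ∑ j ∈ Finset.range (n + 1), layerFree T a b j t x = freeFrom a b (dyadicTime T (n + 1)) t x := by
  induction n with
  | zero =>
    rw [Finset.sum_range_one]
    by_cases h : t ∈ Ioc (dyadicTime T 1) T
    · rw [layerFree_of_mem 0 h, dyadicTime_zero, freeFrom_of_le ht.2, sub_zero]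
    · rw [layerFree_of_not_mem 0 h, freeFrom_of_le (not_lt.1 fun hlt => h ⟨hlt, ht.2⟩)]
  | succ n ih =>
    rw [Finset.sum_range_succ, ih]
    by_cases h : t ∈ Ioc (dyadicTime T (n + 2)) T
    · rw [layerFree_of_mem (n + 1) h]; abel
    · have hle : t ≤ dyadicTime T (n + 2) := not_lt.1 fun hlt => h ⟨hlt, ht.2⟩
      rw [layerFree_of_not_mem (n + 1) h, freeFrom_of_le hle,
        freeFrom_of_le (hle.trans (dyadicTime_succ_lt hF.T_pos (n + 1)).le), add_zero]

/-- **The cumulative free terms converge to the free term from time zero**: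
`Φ_{s_{n+1}}(t)(x) → Φ₀(t)(x)` (the layer integral over `(0, t ∧ s_{n+1})` of the Abel–Beta
integrable `(t-τ)^{-1/2}τ^{α-1}` tends to zero by dominated convergence). [folklore] -/
theorem tendsto_freeFrom_dyadicTime (hF : ForcingPairs T α N a b A B) {t : ℝ} (ht : t ∈ Ioc 0 T) (x : E) :
    Tendsto (fun n => freeFrom a b (dyadicTime T (n + 1)) t x) atTop (𝓝 (freeFrom a b 0 t x)) := by
  have hC := (oseenSliceConst_pos (E := E)).le
  -- the dominating integrals tend to zero
  set g : ℝ → ℝ := fun τ => (t - τ) ^ (-(1 / 2 : ℝ)) * τ ^ (α - 1) with hg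
  have hgI : IntegrableOn g (Ioo 0 t) := integrableOn_abelKernel_mul_rpow hF le_rfl
  have hI : Tendsto (fun n => ∫ τ in Ioo 0 (min t (dyadicTime T (n + 1))), g τ) atTop (𝓝 0) := by
    have heq : ∀ n, ∫ τ in Ioo 0 (min t (dyadicTime T (n + 1))), g τ =
        ∫ τ in Ioo 0 t, (Iio (dyadicTime T (n + 1))).indicator g τ := by
      intro n
      have hset : Ioo 0 (min t (dyadicTime T (n + 1))) = Ioo 0 t ∩ Iio (dyadicTime T (n + 1)) := by
        ext τ
        simp only [mem_inter_iff, mem_Ioo, mem_Iio, lt_min_iff]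
        tauto
      rw [setIntegral_indicator measurableSet_Iio, hset]
    simp_rw [heq]
    have hlimpt : ∀ᵐ τ ∂(volume.restrict (Ioo 0 t)),
        Tendsto (fun n => (Iio (dyadicTime T (n + 1))).indicator g τ) atTop (𝓝 ((fun _ => (0:ℝ)) τ)) := by
      refine ae_restrict_of_forall_mem measurableSet_Ioo fun τ hτ => ?_
      have hev : ∀ᶠ n in atTop, dyadicTime T (n + 1) < τ :=
        ((tendsto_dyadicTime T).comp (tendsto_add_atTop_nat 1)).eventually (gt_mem_nhds hτ.1)
      refine tendsto_const_nhds.congr' (hev.mono fun n hn => ?_)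
      show (0 : ℝ) = (Iio (dyadicTime T (n + 1))).indicator g τ
      rw [indicator_of_notMem (show τ ∉ Iio (dyadicTime T (n + 1)) from not_lt.2 hn.le)]
    have h := tendsto_integral_of_dominated_convergence
      (F := fun n τ => (Iio (dyadicTime T (n + 1))).indicator g τ) (f := fun _ => (0 : ℝ))
      (fun τ => ‖g τ‖) (fun n => (hgI.indicator measurableSet_Iio).aestronglyMeasurable) hgI.norm
      (fun n => Eventually.of_forall fun τ => norm_indicator_le_norm_self _ _) hlimpt
    rwa [integral_zero] at h
  rw [tendsto_iff_norm_sub_tendsto_zero]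
  refine squeeze_zero (g := fun n => oseenSliceConst E * N *
      ∫ τ in Ioo 0 (min t (dyadicTime T (n + 1))), g τ) (fun n => norm_nonneg _) (fun n => ?_) ?_
  · rw [norm_sub_rev]
    exact norm_freeFrom_sub_freeFrom_le hF le_rfl (dyadicTime_pos hF.T_pos _).le ht.2 x
  · have h := hI.const_mul (oseenSliceConst E * N)
    rw [mul_zero] at h
    exact h

/-- **The solution from time zero solves the linearised problem**: for `t ∈ (0, T]`,
`W(t)(x) = Φ₀(t)(x) - B₀(v, W)(t)(x) - B₀(W, v)(t)(x)` (pass `n → ∞` in `partialSol_eq`: dominated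
convergence in the slots under the envelopes `V ≤ K₀τ^{-1/2}`, `C_L N τ^{α-1/2}`).
[cite: CoiculescuPalasek2025, proof of Prop. 4.3] -/
theorem linSol_eq (hF : ForcingPairs T α N a b A B) (hv : LacunaryCoeff T K₀ C η v V)
    (hε : gronwallRate E K₀ C * η ≤ α / 2) {t : ℝ} (ht : t ∈ Ioc 0 T) (x : E) :
    linSol T v a b t x = freeFrom a b 0 t x -
      oseenDuhamel 1 0 v (linSol T v a b) t x - oseenDuhamel 1 0 (linSol T v a b) v t x := by
  set W := linSol T v a b with hW
  set P := partialSol T v a b with hP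
  set S : ℝ → ℝ := fun τ => linSolConst E α K₀ C * N * τ ^ (α - 1 / 2) with hS
  have hCL := (linSolConst_pos (E := E) hF.α_pos K₀ C).le
  have hvb : ∀ τ ∈ Ioo 0 t, ∀ y, ‖v τ y‖ ≤ V τ := fun τ hτ y => hv.bound τ ⟨hτ.1, hτ.2.le.trans ht.2⟩ y
  have hPb : ∀ n, ∀ τ ∈ Ioo 0 t, ∀ y, ‖P n τ y‖ ≤ S τ := fun n τ hτ y =>
    norm_partialSol_le hF hv hε n hτ.1 y
  -- the envelope `(t-τ)^{-1/2} V S` is Abel–Beta integrable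
  have henv : IntegrableOn (fun τ => (t - τ) ^ (-(1 / 2 : ℝ)) * (V τ * S τ)) (Ioo 0 t) ∧
      IntegrableOn (fun τ => (t - τ) ^ (-(1 / 2 : ℝ)) * (S τ * V τ)) (Ioo 0 t) := by
    have hsub : Ioo 0 t ⊆ Ioc 0 T := fun τ hτ => ⟨hτ.1, hτ.2.le.trans ht.2⟩
    have hdom : ∀ τ ∈ Ioo 0 t, ‖(t - τ) ^ (-(1 / 2 : ℝ)) * (V τ * S τ)‖ ≤
        K₀ * (linSolConst E α K₀ C * N) * ((t - τ) ^ (-(1 / 2 : ℝ)) * τ ^ (α - 1)) := by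
      intro τ hτ
      have hk : 0 ≤ (t - τ) ^ (-(1 / 2 : ℝ)) := Real.rpow_nonneg (sub_nonneg.2 hτ.2.le) _
      have hV0 := hv.nonneg τ (hsub hτ)
      have hS0 : 0 ≤ S τ := by
        simp only [hS]; have := hF.N_nonneg; have := (Real.rpow_pos_of_pos hτ.1 (α - 1/2)).le
        positivity
      rw [norm_mul, Real.norm_of_nonneg hk, Real.norm_of_nonneg (mul_nonneg hV0 hS0)]
      -- `V S ≤ K₀ τ^{-1/2} · C_L N τ^{α-1/2} = K₀ C_L N τ^{α-1}`
      have hVK : V τ ≤ K₀ * τ ^ (-(1 / 2 : ℝ)) := by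
        have hk' := hv.kato τ (hsub hτ)
        rw [rpow_neg_half_eq_inv_sqrt hτ.1.le, ← div_eq_mul_inv,
          le_div_iff₀ (Real.sqrt_pos.2 hτ.1), mul_comm]
        exact hk'
      have hprod : V τ * S τ ≤ K₀ * (linSolConst E α K₀ C * N) * τ ^ (α - 1) := by
        calc V τ * S τ ≤ (K₀ * τ ^ (-(1 / 2 : ℝ))) * S τ := mul_le_mul_of_nonneg_right hVK hS0
          _ = K₀ * (linSolConst E α K₀ C * N) * (τ ^ (-(1 / 2 : ℝ)) * τ ^ (α - 1 / 2)) := by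
              simp only [hS]; ring
          _ = K₀ * (linSolConst E α K₀ C * N) * τ ^ (α - 1) := by
              rw [← Real.rpow_add hτ.1]; ring_nf
      calc (t - τ) ^ (-(1 / 2 : ℝ)) * (V τ * S τ)
          ≤ (t - τ) ^ (-(1 / 2 : ℝ)) * (K₀ * (linSolConst E α K₀ C * N) * τ ^ (α - 1)) :=
            mul_le_mul_of_nonneg_left hprod hk
        _ = _ := by ring
    have hm : AEStronglyMeasurable (fun τ => (t - τ) ^ (-(1 / 2 : ℝ)) * (V τ * S τ))
        (volume.restrict (Ioo 0 t)) := by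
      refine ((measurable_sub_rpow_const t _).aestronglyMeasurable.restrict).mul ?_
      refine ((hv.cont.mono hsub).aestronglyMeasurable measurableSet_Ioo).mul ?_
      have hc : ContinuousOn S (Ioo 0 t) := by
        simp only [hS]
        exact continuousOn_const.mul (continuousOn_id.rpow_const fun τ hτ => Or.inl hτ.1.ne')
      exact hc.aestronglyMeasurable measurableSet_Ioo
    have h1 : IntegrableOn (fun τ => (t - τ) ^ (-(1 / 2 : ℝ)) * (V τ * S τ)) (Ioo 0 t) :=
      Integrable.mono' ((integrableOn_abelKernel_mul_rpow hF le_rfl).const_mul _) hm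
        (ae_restrict_of_forall_mem measurableSet_Ioo hdom)
    exact ⟨h1, h1.congr (Eventually.of_forall fun τ => by simp only [mul_comm (V τ)])⟩
  have hmP : ∀ n, Measurable (uncurry (P n)) := measurable_uncurry_partialSol hF hv
  have hlim : ∀ τ y, Tendsto (fun n => P n τ y) atTop (𝓝 (W τ y)) := tendsto_partialSol hF hv hε
  -- convergence of the three terms of the right-hand side
  have hT1 : Tendsto (fun n => oseenDuhamel 1 0 v (P n) t x) atTop (𝓝 (oseenDuhamel 1 0 v W t x)) :=
    tendsto_oseenDuhamel_of_dominated (fun _ => hv.meas) hmP (fun _ => hvb) hPb henv.1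
      (fun τ _ y => tendsto_const_nhds) (fun τ _ y => hlim τ y) x
  have hT2 : Tendsto (fun n => oseenDuhamel 1 0 (P n) v t x) atTop (𝓝 (oseenDuhamel 1 0 W v t x)) :=
    tendsto_oseenDuhamel_of_dominated hmP (fun _ => hv.meas) hPb (fun _ => hvb) henv.2
      (fun τ _ y => hlim τ y) (fun τ _ y => tendsto_const_nhds) x
  have hT0 := tendsto_freeFrom_dyadicTime hF ht x
  have hrhs : Tendsto (fun n => freeFrom a b (dyadicTime T (n + 1)) t x -
      oseenDuhamel 1 0 v (P n) t x - oseenDuhamel 1 0 (P n) v t x) atTop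
      (𝓝 (freeFrom a b 0 t x - oseenDuhamel 1 0 v W t x - oseenDuhamel 1 0 W v t x)) :=
    (hT0.sub hT1).sub hT2
  have heq : (fun n => P n t x) = fun n => freeFrom a b (dyadicTime T (n + 1)) t x -
      oseenDuhamel 1 0 v (P n) t x - oseenDuhamel 1 0 (P n) v t x := by
    funext n
    rw [hP, partialSol_eq hF hv n ht x, sum_layerFree_eq hF n ht x]
  have hlhs : Tendsto (fun n => P n t x) atTop (𝓝 (W t x)) := hlim t x
  rw [heq] at hlhs
  exact tendsto_nhds_unique hlhs hrhs

/-- **The linear solution operator of the perturbation step (Props. 4.2–4.3 of Coiculescu–Palasek,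
linear part, in forcing form, with sup norms only).** Under `ForcingPairs` (forcing pairs with
`Σ AᵢBᵢ ≤ Nτ^{α-1}`), `LacunaryCoeff` ((3.13a), (3.13b)) and the smallness `Λη ≤ α/2` of the
lacunarity slope, the field `W = linSol T v a b` is jointly measurable, vanishes off `(0, T]`,
obeys `‖W(t)(x)‖ ≤ C_L N t^{α-1/2}` and solves
`W(t) = Σᵢ B₀(aᵢ, bᵢ)(t) - B₀(v, W)(t) - B₀(W, v)(t)` on `(0, T]` — the mild form of
`∂ₜW - ΔW + ℙ∇·(v ⊗ W + W ⊗ v) = ℙ∇·(Σᵢ aᵢ ⊗ bᵢ)`, `W(0) = 0`. [cite: CoiculescuPalasek2025, Props. 4.2–4.3] -/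
theorem linSol_spec (hF : ForcingPairs T α N a b A B) (hv : LacunaryCoeff T K₀ C η v V)
    (hε : gronwallRate E K₀ C * η ≤ α / 2) :
    Measurable (uncurry (linSol T v a b)) ∧
    (∀ t, t ∉ Ioc 0 T → ∀ x, linSol T v a b t x = 0) ∧
    (∀ t ∈ Ioc 0 T, ∀ x, ‖linSol T v a b t x‖ ≤ linSolConst E α K₀ C * N * t ^ (α - 1 / 2)) ∧
    (∀ t ∈ Ioc 0 T, ∀ x, linSol T v a b t x = freeFrom a b 0 t x -
      oseenDuhamel 1 0 v (linSol T v a b) t x - oseenDuhamel 1 0 (linSol T v a b) v t x) :=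
  ⟨measurable_uncurry_linSol hF hv hε, fun _ ht x => linSol_of_not_mem hF hv hε ht x,
    fun _ ht x => norm_linSol_le hF hv hε ht.1 x, fun _ ht x => linSol_eq hF hv hε ht x⟩

end Equation

end Literature.Analysis.FluidPDE
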